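import Summits.HodgeConjecture.CorCM.Census.OcticWeilFourfoldParts
import Summits.HodgeConjecture.CorCM.OcticCurveFourfoldPowersHodgeOfMarkman
import Summits.HodgeConjecture.CorCM.CMProductFourfoldsOfMarkman
import Summits.HodgeConjecture.CorCM.CMWeightPullbackSubproduct
import HarnessLib

/-!
# COR-CM — `B × E` for a SIMPLE CM fourfold of WEIL TYPE (`k`-signature `(2,2)`): the WEIL PARTS of every product of
# copies have algebraic lines, GIVEN Markman's FOURFOLD theorem

Cell `pub-hodgecm2` (COR-CM), seat b30 gen 19 (2026-08-21); count-neutral own lane OCTIC-WEIL22.  Theorems only; no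
definition, no named fact introduced, no `sorry`.  HONEST FRAMING: the algebraicity statements are CONDITIONAL on the
displayed named fact `HodgeTheory.Markman2025_weilClasses_algebraic_abelianFourfold` (E. Markman, arXiv:2502.03415 /
2509.23403 Thm. 1.2, unrefereed); `HC_CM` is not asserted.

SETTING (as in `CorCM/OcticWeilFourfoldFrameTransfer.lean`).  `k = Kf i₀`, `F = Kf i₁ ⊇ i(k)` octic, two slots
`curveSlots₂ i₀ i₁ = (i₁, i₀)`, realisations `A₂ 0 = B ⊨ (F; Φ)`, `A₂ 1 = E ⊨ (k; Ψ)`, and the TYPE COUNT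
`#{s ∈ Φ | s ∘ i = τ'} = 2` for every `τ' : k → ℂ` (`hcount`: `k`-signature `(2,2)`; `B` is an abelian fourfold of Weil
type for `k`).

* §1 `card_filter_comp_eq_and_comp` — `Aut(ℂ)` maps the fibre of `τ₁` bijectively onto the fibre of `ρ ∘ τ₁`, so
  the fibre meets `ρ⁻¹Φ` and `ρ⁻¹Φ̄` in two embeddings each (`card_filter_comp_eq_and_comp_mem_eq`);
* §2 **`weilWeight_mem_pohlmannSetsAlg`** — the WEIL WEIGHT `{(0, s) : s ∘ i = τ₁}` of the one-slot product
  `⨁_{Fin 1} B` (the weight of the Weil line `⋀⁴ H¹(B)_{τ₁} ⊆ W_k(B) ⊗ ℂ`) is `Aut(ℂ)`-balanced — from the count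
  alone, no frame, no Galois hypothesis; **`weightClassesAlg_weilWeight_le_algebraicClasses_of_markman`** — its line
  is algebraic GIVEN Markman's theorem:
  `⨁_{Fin 1} B` has dimension `4`, so the cell's `CMWeights.weightClassesAlg_le_algebraicClasses_two_of_markman`
  (every balanced weight of a CM-product FOURFOLD is algebraic: divisor monomial or Weil section) applies;
  `weightClassesAlg_weilWeight₂_le_algebraicClasses_of_markman` — pulled back to `Y = B ⊞ E` along the projection
  (`CMWeights.weightClassesAlg_map_le_algebraicClasses`, Moonen–Zarhin's «pull-backs of Weil classes of quotients»);
* §3 **`weightClassesAlg_le_algebraicClasses_of_isWeil₂Part`** — a Weil part (`Census/OcticWeilFourfoldParts.IsWeil₂Part`)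
  of a weight of `X = ⨁_j A₂(κ j)` has an algebraic line: it projects injectively onto the Weil weight of `Y` (frame:
  sign `b` = fibre of `τ` or `τ̄`), and seat b30's distribution lemma (`CMWeights.weightClassesAlg_comp_le_algebraicClasses_of_injOn`)
  lifts algebraicity along `κ`.
[cite: Markman2025SurveySecant, Thm. 1.2] [cite: MoonenZarhin1999LowDim, Thm. 0.2 and (2.8)]
[cite: Milne2020HodgeClassesAV, 1.2 (a) and Thm. 1] [cite: Deligne1982HodgeCycles, §4 Prop. 4.4]

## References
* [Markman2025SurveySecant] E. Markman, arXiv:2509.23403 (2025), Thm. 1.2, §1.1 (fourfolds of Weil type; unrefereed).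
* [MoonenZarhin1999LowDim] B. Moonen, Yu. Zarhin, Math. Ann. 315 (1999), Thm. 0.2, (2.8).
* [Milne2020HodgeClassesAV] J. S. Milne, arXiv:2010.08857, 1.2 (a), Thm. 1.  [Deligne1982HodgeCycles] P. Deligne, LNM
  900 (1982), §4 Prop. 4.4, §5.  [MoonenZarhin1995Duke] B. Moonen, Yu. Zarhin, Duke Math. J. 77 (1995), Thm. 2.4.
-/

noncomputable section

open CategoryTheory CategoryTheory.Limits NumberField

namespace Summit.HodgeConjecture.CorCM.OcticWeilFourfold

open Literature.AlgebraicGeometry Literature.AlgebraicGeometry.Motives Literature.AlgebraicGeometry.HodgeTheory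
open Literature.AlgebraicGeometry.ComplexMultiplication (IsCMTypeRealisation)
open Literature.AlgebraicGeometry.Pohlmann1968
open Literature.AlgebraicTopology.SingularHomology
open Literature.NumberTheory.ComplexMultiplication
open Summit.HodgeConjecture.CorCM.Census.OcticCurveFourfold (Pt)
open Summit.HodgeConjecture.CorCM.Census.OcticWeilFourfold (IsWeil₂Part)
open Summit.HodgeConjecture.CorCM.OcticCurveFourfold (toPt toPt_zero toPt_one toPt_injective comp_injective
  comp_eq_conjugate_of_snd_eq_false card_filter_comp_eq_four)
open Summit.HodgeConjecture.CorCM.DecicCurveFivefold (curveSlots₂ sigma_cases)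
open Summit.HodgeConjecture.CorCM.CMWeights (weightClassesAlg_comp_le_algebraicClasses_of_injOn
  weightClassesAlg_map_le_algebraicClasses weightClassesAlg_le_algebraicClasses_two_of_markman sum_finrank_eq_two_mul_dim)
open Summit.HodgeConjecture.CorCM.DihedralSexticPairCurvePowers (ncard_sep_eq_card_filter)

open scoped Classical Pointwise

/-! ## §1 Fibres of the quadratic subfield under `Aut(ℂ)` (type count only) -/

section Fibre

variable {K k : Type} [Field K] [NumberField K] [Field k] (i : k →+* K)

/-- **An automorphism of `ℂ` maps the fibre of `τ₁` bijectively onto the fibre of `ρ ∘ τ₁`**, compatibly with any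
predicate read after `ρ`: `#{s | s ∘ i = τ₁ ∧ Q(ρ ∘ s)} = #{s' | s' ∘ i = ρ ∘ τ₁ ∧ Q(s')}`. [folklore] -/
theorem card_filter_comp_eq_and_comp (ρ : ℂ ≃+* ℂ) (τ₁ : k →+* ℂ) (Q : (K →+* ℂ) → Prop) :
    (Finset.univ.filter fun s : K →+* ℂ => s.comp i = τ₁ ∧ Q ((ρ : ℂ →+* ℂ).comp s)).card =
      (Finset.univ.filter fun s' : K →+* ℂ => s'.comp i = (ρ : ℂ →+* ℂ).comp τ₁ ∧ Q s').card := by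
  refine Finset.card_bij (fun s _ => (ρ : ℂ →+* ℂ).comp s) (fun s hs => ?_) (fun s hs s' hs' h => ?_) fun s' hs' => ?_
  · obtain ⟨-, h1, h2⟩ := Finset.mem_filter.1 hs
    exact Finset.mem_filter.2 ⟨Finset.mem_univ _, by rw [RingHom.comp_assoc, h1], h2⟩
  · exact comp_injective (K := K) ρ h
  · obtain ⟨-, h1, h2⟩ := Finset.mem_filter.1 hs'
    have hρρ : (ρ : ℂ →+* ℂ).comp ((ρ.symm : ℂ →+* ℂ).comp s') = s' :=
      RingHom.ext fun x => ρ.apply_symm_apply (s' x)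
    refine ⟨(ρ.symm : ℂ →+* ℂ).comp s', Finset.mem_filter.2 ⟨Finset.mem_univ _, ?_, by rw [hρρ]; exact h2⟩, hρρ⟩
    apply comp_injective (K := k) ρ
    change (ρ : ℂ →+* ℂ).comp (((ρ.symm : ℂ →+* ℂ).comp s').comp i) = (ρ : ℂ →+* ℂ).comp τ₁
    rw [← RingHom.comp_assoc, hρρ, h1]

/-- **The type count on the complement**: if each fibre has `4` elements and meets `Φ` in `2`, it meets `Φ̄` in `2`.
[cite: Deligne1982HodgeCycles, §4 Prop. 4.4] -/
theorem card_filter_comp_eq_and_not (Φ : Set (K →+* ℂ))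
    (h4 : ∀ τ' : k →+* ℂ, (Finset.univ.filter fun s : K →+* ℂ => s.comp i = τ').card = 4)
    (hcount : ∀ τ' : k →+* ℂ, (Finset.univ.filter fun s : K →+* ℂ => s.comp i = τ' ∧ s ∈ Φ).card = 2)
    (τ' : k →+* ℂ) : (Finset.univ.filter fun s : K →+* ℂ => s.comp i = τ' ∧ s ∉ Φ).card = 2 := by
  have hsplit := Finset.card_filter_add_card_filter_not
    (s := Finset.univ.filter fun s : K →+* ℂ => s.comp i = τ') (fun s => s ∈ Φ)
  rw [Finset.filter_filter, Finset.filter_filter, h4 τ', hcount τ'] at hsplit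
  omega

/-- **The Weil weight `{s | s ∘ i = τ₁}` is `Aut(ℂ)`-balanced, read through any injection `f` into an index set**:
for every `ρ`, `#{s | s ∘ i = τ₁ ∧ ρ ∘ s ∈ Φ} = #{s | s ∘ i = τ₁ ∧ ρ ∘ s ∉ Φ}` (`= 2`), the fibre of `τ₁` going
bijectively to the fibre of `ρ ∘ τ₁`. [cite: Deligne1982HodgeCycles, §4 Prop. 4.4] [cite: MoonenZarhin1995Duke, Thm. 2.4] -/
theorem card_filter_comp_eq_and_comp_mem_eq (Φ : Set (K →+* ℂ))
    (h4 : ∀ τ' : k →+* ℂ, (Finset.univ.filter fun s : K →+* ℂ => s.comp i = τ').card = 4)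
    (hcount : ∀ τ' : k →+* ℂ, (Finset.univ.filter fun s : K →+* ℂ => s.comp i = τ' ∧ s ∈ Φ).card = 2)
    (ρ : ℂ ≃+* ℂ) (τ₁ : k →+* ℂ) :
    (Finset.univ.filter fun s : K →+* ℂ => s.comp i = τ₁ ∧ (ρ : ℂ →+* ℂ).comp s ∈ Φ).card = 2 ∧
      (Finset.univ.filter fun s : K →+* ℂ => s.comp i = τ₁ ∧ (ρ : ℂ →+* ℂ).comp s ∉ Φ).card = 2 := by
  refine ⟨by rw [card_filter_comp_eq_and_comp i ρ τ₁ (fun s' => s' ∈ Φ), hcount], ?_⟩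
  have h := card_filter_comp_eq_and_comp i ρ τ₁ (fun s' => s' ∉ Φ)
  have h' := card_filter_comp_eq_and_not i Φ h4 hcount ((ρ : ℂ →+* ℂ).comp τ₁)
  calc (Finset.univ.filter fun s : K →+* ℂ => s.comp i = τ₁ ∧ (ρ : ℂ →+* ℂ).comp s ∉ Φ).card
      = (Finset.univ.filter fun s' : K →+* ℂ => s'.comp i = (ρ : ℂ →+* ℂ).comp τ₁ ∧ s' ∉ Φ).card := by
        convert h using 4
    _ = 2 := h'

end Fibre

/-! ## §2 The Weil weight of the one-slot product `⨁_{Fin 1} B` is balanced and algebraic given Markman -/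

section Markman

variable {I : Type} {Kf : I → Type} [∀ i, Field (Kf i)] [∀ i, NumberField (Kf i)] [∀ i, IsCMField (Kf i)]
  {i₀ i₁ : I} (i : Kf i₀ →+* Kf i₁)
  {A₂ : Fin 2 → AbelianVariety ℂ} {Φ₂ : ∀ j : Fin 2, CMType (Kf (curveSlots₂ i₀ i₁ j))}
  {ι₂ : ∀ j, 𝓞 (Kf (curveSlots₂ i₀ i₁ j)) →+* End (A₂ j)}
  {θ₂ : ∀ j, Kf (curveSlots₂ i₀ i₁ j) →+* Module.End ℂ (complexBetti (A₂ j).X 1)}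

omit [∀ i, NumberField (Kf i)] [∀ i, IsCMField (Kf i)] in
/-- The index map `s ↦ (0, s)` into the index set of the one-slot product is injective. [folklore] -/
theorem sigmaMk_one_injective : Function.Injective fun s : Kf i₁ →+* ℂ =>
    (⟨(0 : Fin 1), s⟩ : (j : Fin 1) × (Kf (curveSlots₂ i₀ i₁ ((fun _ : Fin 1 => (0 : Fin 2)) j)) →+* ℂ)) :=
  fun s s' h => by cases h; rfl

omit [∀ i, NumberField (Kf i)] [∀ i, IsCMField (Kf i)] in
/-- The index map `s ↦ (0, s)` into the index set of `Y = B ⊞ E` is injective. [folklore] -/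
theorem sigmaMk_two_injective : Function.Injective fun s : Kf i₁ →+* ℂ =>
    (⟨(0 : Fin 2), s⟩ : (m : Fin 2) × (Kf (curveSlots₂ i₀ i₁ m) →+* ℂ)) :=
  fun s s' h => by cases h; rfl

omit [∀ i, IsCMField (Kf i)] in
/-- **THE WEIL WEIGHT of the one-slot product `⨁_{Fin 1} B` is `Aut(ℂ)`-balanced**: the weight `{(0, s) | s ∘ i = τ₁}`
(of the Weil line `⋀⁴ H¹(B)_{τ₁} ⊆ W_k(B) ⊗ ℂ`) lies in `pohlmannSetsAlg _ 2`, from the TYPE COUNT `#{s ∈ Φ | s ∘ i = τ'}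
= 2` alone (§1) — no frame, no Galois hypothesis. [cite: Deligne1982HodgeCycles, §4 Prop. 4.4] [cite: MoonenZarhin1995Duke, Thm. 2.4] -/
theorem weilWeight_mem_pohlmannSetsAlg (h8 : Module.finrank ℚ (Kf i₁) = 8) (h2 : Module.finrank ℚ (Kf i₀) = 2)
    (hcount : ∀ τ' : Kf i₀ →+* ℂ, (Finset.univ.filter fun s : Kf i₁ →+* ℂ => s.comp i = τ' ∧ s ∈ (Φ₂ 0).1).card = 2)
    (τ₁ : Kf i₀ →+* ℂ) :
    ((Finset.univ.filter fun s : Kf i₁ →+* ℂ => s.comp i = τ₁).image fun s : Kf i₁ →+* ℂ =>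
        (⟨(0 : Fin 1), s⟩ : (j : Fin 1) × (Kf (curveSlots₂ i₀ i₁ ((fun _ : Fin 1 => (0 : Fin 2)) j)) →+* ℂ))) ∈
      pohlmannSetsAlg (K := fun j : Fin 1 => Kf (curveSlots₂ i₀ i₁ ((fun _ : Fin 1 => (0 : Fin 2)) j)))
        (fun j => Φ₂ ((fun _ : Fin 1 => (0 : Fin 2)) j)) 2 := by
  have h4 : ∀ τ' : Kf i₀ →+* ℂ, (Finset.univ.filter fun s : Kf i₁ →+* ℂ => s.comp i = τ').card = 4 :=
    card_filter_comp_eq_four i h8 h2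
  have hci := Finset.card_image_of_injective (Finset.univ.filter fun s : Kf i₁ →+* ℂ => s.comp i = τ₁)
    (sigmaMk_one_injective (i₀ := i₀) (i₁ := i₁))
  refine ⟨by rw [hci, h4 τ₁], fun ρ => ?_⟩
  rw [ncard_sep_eq_card_filter, ncard_sep_eq_card_filter, Finset.filter_image, Finset.filter_image,
    Finset.card_image_of_injective _ (sigmaMk_one_injective (i₀ := i₀) (i₁ := i₁)),
    Finset.card_image_of_injective _ (sigmaMk_one_injective (i₀ := i₀) (i₁ := i₁)), Finset.filter_filter,
    Finset.filter_filter]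
  obtain ⟨hin, hout⟩ := card_filter_comp_eq_and_comp_mem_eq i (Φ₂ 0).1 h4 hcount ρ τ₁
  exact hin.trans hout.symm

variable (hA : ∀ j, IsCMTypeRealisation (Φ₂ j) (A₂ j) (ι₂ j) (θ₂ j))

include hA in
omit [∀ i, IsCMField (Kf i)] in
/-- The one-slot product `⨁_{Fin 1} B` has dimension `4` (`[F:ℚ] = 8`). [folklore] -/
theorem dim_biproduct_one_eq_four (h8 : Module.finrank ℚ (Kf i₁) = 8) :
    (⨁ fun j : Fin 1 => A₂ ((fun _ : Fin 1 => (0 : Fin 2)) j)).dim = 4 := by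
  have h := sum_finrank_eq_two_mul_dim (K := fun j : Fin 1 => Kf (curveSlots₂ i₀ i₁ ((fun _ : Fin 1 => (0 : Fin 2)) j)))
    (fun j => hA ((fun _ : Fin 1 => (0 : Fin 2)) j))
  rw [Fin.sum_univ_one] at h
  change Module.finrank ℚ (Kf i₁) = _ at h
  omega

include hA in
/-- **The Weil weight of `⨁_{Fin 1} B` has an algebraic line, GIVEN Markman's theorem**: the product has dimension `4`
and the weight is balanced (`weilWeight_mem_pohlmannSetsAlg`), so the cell's
`CMWeights.weightClassesAlg_le_algebraicClasses_two_of_markman` applies (a balanced `4`-set of a CM-product fourfold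
indexes a divisor monomial or is a Weil section; here the latter: the line `⋀⁴ H¹(B)_{τ₁}` of `W_k(B) ⊗ ℂ`, whose
rational `(2,2)` classes are algebraic by the named fact). [cite: Markman2025SurveySecant, Thm. 1.2 and §1.1]
[cite: MoonenZarhin1995Duke, Thm. 2.4] -/
theorem weightClassesAlg_weilWeight_le_algebraicClasses_of_markman (hW4 : Markman2025_weilClasses_algebraic_abelianFourfold)
    (h8 : Module.finrank ℚ (Kf i₁) = 8) (h2 : Module.finrank ℚ (Kf i₀) = 2)
    (hcount : ∀ τ' : Kf i₀ →+* ℂ, (Finset.univ.filter fun s : Kf i₁ →+* ℂ => s.comp i = τ' ∧ s ∈ (Φ₂ 0).1).card = 2)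
    (τ₁ : Kf i₀ →+* ℂ) :
    weightClassesAlg (fun j : Fin 1 => A₂ ((fun _ : Fin 1 => (0 : Fin 2)) j))
        (fun j => ι₂ ((fun _ : Fin 1 => (0 : Fin 2)) j)) (2 * 2)
        ((Finset.univ.filter fun s : Kf i₁ →+* ℂ => s.comp i = τ₁).image fun s : Kf i₁ →+* ℂ =>
          (⟨(0 : Fin 1), s⟩ : (j : Fin 1) × (Kf (curveSlots₂ i₀ i₁ ((fun _ : Fin 1 => (0 : Fin 2)) j)) →+* ℂ))) ≤
      algebraicClasses (⨁ fun j : Fin 1 => A₂ ((fun _ : Fin 1 => (0 : Fin 2)) j)).X 2 :=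
  weightClassesAlg_le_algebraicClasses_two_of_markman hW4 (fun j => hA ((fun _ : Fin 1 => (0 : Fin 2)) j))
    (dim_biproduct_one_eq_four hA h8) (weilWeight_mem_pohlmannSetsAlg i h8 h2 hcount τ₁)

include hA in
/-- **… and so does the Weil weight `{(0, s) | s ∘ i = τ₁}` of `Y = B ⊞ E`** (pull-back along the projection
`Y → ⨁_{Fin 1} B`: `CMWeights.weightClassesAlg_map_le_algebraicClasses`, Moonen–Zarhin's pull-backs of Weil classes of
quotients read in eigen-coordinates). [cite: MoonenZarhin1999LowDim, Thm. 0.2 and (2.8)] [cite: Markman2025SurveySecant, Thm. 1.2] -/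
theorem weightClassesAlg_weilWeight₂_le_algebraicClasses_of_markman (hW4 : Markman2025_weilClasses_algebraic_abelianFourfold)
    (h8 : Module.finrank ℚ (Kf i₁) = 8) (h2 : Module.finrank ℚ (Kf i₀) = 2)
    (hcount : ∀ τ' : Kf i₀ →+* ℂ, (Finset.univ.filter fun s : Kf i₁ →+* ℂ => s.comp i = τ' ∧ s ∈ (Φ₂ 0).1).card = 2)
    (τ₁ : Kf i₀ →+* ℂ) :
    weightClassesAlg A₂ ι₂ (2 * 2)
        ((Finset.univ.filter fun s : Kf i₁ →+* ℂ => s.comp i = τ₁).image fun s : Kf i₁ →+* ℂ =>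
          (⟨(0 : Fin 2), s⟩ : (m : Fin 2) × (Kf (curveSlots₂ i₀ i₁ m) →+* ℂ))) ≤
      algebraicClasses (⨁ A₂).X 2 := by
  have he : Function.Injective (fun _ : Fin 1 => (0 : Fin 2)) := fun a b _ => Subsingleton.elim a b
  have hS''card : ((Finset.univ.filter fun s : Kf i₁ →+* ℂ => s.comp i = τ₁).image fun s : Kf i₁ →+* ℂ =>
      (⟨(0 : Fin 1), s⟩ : (j : Fin 1) × (Kf (curveSlots₂ i₀ i₁ ((fun _ : Fin 1 => (0 : Fin 2)) j)) →+* ℂ))).card =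
      2 * 2 := by
    rw [Finset.card_image_of_injective _ (sigmaMk_one_injective (i₀ := i₀) (i₁ := i₁)),
      card_filter_comp_eq_four i h8 h2 τ₁]
  have h := weightClassesAlg_map_le_algebraicClasses hA (fun _ : Fin 1 => (0 : Fin 2)) he hS''card
    (weightClassesAlg_weilWeight_le_algebraicClasses_of_markman i hA hW4 h8 h2 hcount τ₁)
  rw [Finset.map_eq_image, Finset.image_image] at h
  exact h

end Markman

/-! ## §3 Weil parts of the powers have algebraic lines -/

section Parts

variable {I : Type} {Kf : I → Type} [∀ i, Field (Kf i)] [∀ i, NumberField (Kf i)] [∀ i, IsCMField (Kf i)]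
  {i₀ i₁ : I} {N : ℕ} (κ : Fin N → Fin 2) {e : (Kf i₁ →+* ℂ) ≃ Fin 4 × Bool} {τ : Kf i₀ →+* ℂ} {i : Kf i₀ →+* Kf i₁}
  {A₂ : Fin 2 → AbelianVariety ℂ} {Φ₂ : ∀ j : Fin 2, CMType (Kf (curveSlots₂ i₀ i₁ j))}
  {ι₂ : ∀ j, 𝓞 (Kf (curveSlots₂ i₀ i₁ j)) →+* End (A₂ j)}
  {θ₂ : ∀ j, Kf (curveSlots₂ i₀ i₁ j) →+* Module.End ℂ (complexBetti (A₂ j).X 1)}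

omit [∀ i, NumberField (Kf i)] [∀ i, IsCMField (Kf i)] in
/-- In the frame, sign `b` is the fibre of `τ` (`b = true`) or of `τ̄` (`b = false`). [folklore] -/
theorem snd_eq_iff_comp_eq (hk : ∀ σ : Kf i₀ →+* ℂ, σ = τ ∨ σ = ComplexEmbedding.conjugate τ)
    (hττ : ComplexEmbedding.conjugate τ ≠ τ) (he_sign : ∀ s : Kf i₁ →+* ℂ, (e s).2 = true ↔ s.comp i = τ)
    (b : Bool) (s : Kf i₁ →+* ℂ) :
    (e s).2 = b ↔ s.comp i = (if b then τ else ComplexEmbedding.conjugate τ) := by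
  cases b
  · rw [if_neg Bool.false_ne_true]
    constructor
    · exact comp_eq_conjugate_of_snd_eq_false hk he_sign
    · intro h
      cases hs : (e s).2
      · rfl
      · exact absurd (((he_sign s).1 hs).symm.trans h) hττ.symm
  · rw [if_pos rfl, he_sign]

/-- **A Weil part of a weight of `X = ⨁_j A₂(κ j)` has an algebraic line, GIVEN Markman's fourfold theorem**: the slot
projection `P` is injective on it with image the Weil weight `{(0, s) | s ∘ i = τ_b}` of `Y = B ⊞ E`
(`IsWeil₂Part.image_eq`, `toPt_injective`), whose line is algebraic (§2); seat b30's distribution lemma lifts this along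
`κ`. [cite: Milne2020HodgeClassesAV, 1.2 (a) and Thm. 1] [cite: Markman2025SurveySecant, Thm. 1.2] -/
theorem weightClassesAlg_le_algebraicClasses_of_isWeil₂Part (hW4 : Markman2025_weilClasses_algebraic_abelianFourfold)
    (h8 : Module.finrank ℚ (Kf i₁) = 8) (h2 : Module.finrank ℚ (Kf i₀) = 2)
    (hττ : ComplexEmbedding.conjugate τ ≠ τ) (hk : ∀ σ : Kf i₀ →+* ℂ, σ = τ ∨ σ = ComplexEmbedding.conjugate τ)
    (he_sign : ∀ s : Kf i₁ →+* ℂ, (e s).2 = true ↔ s.comp i = τ)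
    (hA : ∀ j, IsCMTypeRealisation (Φ₂ j) (A₂ j) (ι₂ j) (θ₂ j))
    (hcount : ∀ τ' : Kf i₀ →+* ℂ, (Finset.univ.filter fun s : Kf i₁ →+* ℂ => s.comp i = τ' ∧ s ∈ (Φ₂ 0).1).card = 2)
    {b : Bool} {G : Finset ((j : Fin N) × (Kf (curveSlots₂ i₀ i₁ (κ j)) →+* ℂ))}
    (hG : IsWeil₂Part (fun x => toPt e τ ((Sigma.map κ (fun _ => id) :
      ((j : Fin N) × (Kf (curveSlots₂ i₀ i₁ (κ j)) →+* ℂ)) → ((m : Fin 2) × (Kf (curveSlots₂ i₀ i₁ m) →+* ℂ))) x)) b G) :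
    G.card = 2 * 2 ∧ weightClassesAlg (fun j => A₂ (κ j)) (fun j => ι₂ (κ j)) (2 * 2) G ≤
      algebraicClasses (⨁ fun j => A₂ (κ j)).X 2 := by
  set P : ((j : Fin N) × (Kf (curveSlots₂ i₀ i₁ (κ j)) →+* ℂ)) → ((m : Fin 2) × (Kf (curveSlots₂ i₀ i₁ m) →+* ℂ)) :=
    Sigma.map κ (fun _ => id) with hP
  have hinjv := hG.injOn
  have hPinj : Set.InjOn P ↑G := fun x hx x' hx' h => hinjv hx hx' (by change toPt e τ (P x) = toPt e τ (P x'); rw [h])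
  have hq : G.card = 2 * 2 := by rw [hG.1]
  set τb : Kf i₀ →+* ℂ := if b then τ else ComplexEmbedding.conjugate τ with hτb
  -- the image of `G` under `P` is the Weil weight of `Y` over `τ_b`
  have hGim : (G.image P).image (toPt e τ) = (Finset.univ : Finset (Fin 4)).image fun a => (Sum.inr (a, b) : Pt) := by
    rw [Finset.image_image]; exact hG.image_eq
  have himg : G.image P = (Finset.univ.filter fun s : Kf i₁ →+* ℂ => s.comp i = τb).image fun s : Kf i₁ →+* ℂ =>
      (⟨(0 : Fin 2), s⟩ : (m : Fin 2) × (Kf (curveSlots₂ i₀ i₁ m) →+* ℂ)) := by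
    ext y
    constructor
    · intro hy
      have hty : toPt e τ y ∈ (Finset.univ : Finset (Fin 4)).image fun a => (Sum.inr (a, b) : Pt) :=
        hGim ▸ Finset.mem_image_of_mem _ hy
      obtain ⟨a, -, ha⟩ := Finset.mem_image.1 hty
      rcases sigma_cases y with ⟨s, rfl⟩ | ⟨σ, rfl⟩
      · rw [toPt_zero, Sum.inr.injEq] at ha
        refine Finset.mem_image.2 ⟨s, Finset.mem_filter.2 ⟨Finset.mem_univ _, ?_⟩, rfl⟩
        exact (snd_eq_iff_comp_eq hk hττ he_sign b s).1 (by rw [← ha])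
      · rw [toPt_one] at ha
        exact absurd ha Sum.inr_ne_inl
    · intro hy
      obtain ⟨s, hs, rfl⟩ := Finset.mem_image.1 hy
      have hsb : (e s).2 = b := (snd_eq_iff_comp_eq hk hττ he_sign b s).2 (Finset.mem_filter.1 hs).2
      have hmem : (Sum.inr (e s) : Pt) ∈ (G.image P).image (toPt e τ) := by
        rw [hGim]
        exact Finset.mem_image.2 ⟨(e s).1, Finset.mem_univ _, by rw [← hsb]⟩
      obtain ⟨y, hy', hty⟩ := Finset.mem_image.1 hmem
      have : y = ⟨(0 : Fin 2), s⟩ := toPt_injective hττ hk (by rw [hty, toPt_zero])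
      rwa [this] at hy'
  have hYalg := weightClassesAlg_weilWeight₂_le_algebraicClasses_of_markman i hA hW4 h8 h2 hcount τb
  rw [← himg] at hYalg
  exact ⟨hq, weightClassesAlg_comp_le_algebraicClasses_of_injOn (K := fun m => Kf (curveSlots₂ i₀ i₁ m)) hA κ hq
    hPinj hYalg⟩

end Parts

end Summit.HodgeConjecture.CorCM.OcticWeilFourfold

end
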